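import Mathlib

/-!
# P2B `FieldFibreDescendsRegular` — Core definitions and lemmas

Core machinery for P2B (port from `Cruxes/DescentPerfectToAll/Lines/field_fibre_descends_regular.lean`).
bears_on: LADDER-RESOLUTION:B · [OURS · CANDIDATE] counted 0; nothing here proves resolution in char p.
-/

set_option linter.dupNamespace false

open IsLocalRing

namespace Summit.ResolutionOfSingularities.ResolutionOfSingularities.Theorems.Descent.FieldFibre

/-- P2B statement. -/
def FieldFibreDescendsRegular : Prop :=
  ∀ (S R A : Type) [CommRing S] [IsRegularLocalRing S] [IsDomain S] [IsIntegrallyClosed S]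
    [CommRing R] [IsLocalRing R] [Algebra S R] [CommRing A] [IsDomain A] [Algebra S A]
    [Module.Finite S A],
    IsLocalHom (algebraMap S R) → Function.Injective (algebraMap S A) →
    ∀ (𝔫 : Ideal (TensorProduct S A R)) [𝔫.IsPrime],
      (IsLocalRing.maximalIdeal R).map
          (Algebra.TensorProduct.includeRight : R →ₐ[S] TensorProduct S A R) ≤ 𝔫 →
      (∀ b ∈ 𝔫, ∃ u ∉ 𝔫, u * b ∈ (IsLocalRing.maximalIdeal R).map
          (Algebra.TensorProduct.includeRight : R →ₐ[S] TensorProduct S A R)) →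
      IsRegularLocalRing (Localization.AtPrime
        (𝔫.comap (Algebra.TensorProduct.includeLeftRingHom : A →+* TensorProduct S A R)))

/-- (Stub 1 proved.) The maximal ideal of `A_𝔮` is extended from `S`. -/
def FibreMaximalIdealExtended : Prop :=
  ∀ (S R A : Type) [CommRing S] [IsRegularLocalRing S] [IsDomain S] [IsIntegrallyClosed S]
    [CommRing R] [IsLocalRing R] [Algebra S R] [CommRing A] [IsDomain A] [Algebra S A]
    [Module.Finite S A],
    IsLocalHom (algebraMap S R) → Function.Injective (algebraMap S A) →
    ∀ (𝔫 : Ideal (TensorProduct S A R)) [𝔫.IsPrime],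
      (IsLocalRing.maximalIdeal R).map
          (Algebra.TensorProduct.includeRight : R →ₐ[S] TensorProduct S A R) ≤ 𝔫 →
      (∀ b ∈ 𝔫, ∃ u ∉ 𝔫, u * b ∈ (IsLocalRing.maximalIdeal R).map
          (Algebra.TensorProduct.includeRight : R →ₐ[S] TensorProduct S A R)) →
      IsLocalRing.maximalIdeal (Localization.AtPrime
        (𝔫.comap (Algebra.TensorProduct.includeLeftRingHom : A →+* TensorProduct S A R))) =
      (IsLocalRing.maximalIdeal S).map (algebraMap S (Localization.AtPrime
        (𝔫.comap (Algebra.TensorProduct.includeLeftRingHom : A →+* TensorProduct S A R))))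

/-- (Stub 2 proved.) Dimension preserved in finite extension at prime over maximal. -/
def DimPreservedOverMaximal : Prop :=
  ∀ (S A : Type) [CommRing S] [IsLocalRing S] [IsNoetherianRing S] [IsDomain S]
    [IsIntegrallyClosed S] [CommRing A] [IsDomain A] [Algebra S A] [Module.Finite S A],
    Function.Injective (algebraMap S A) →
    ∀ (𝔮 : Ideal A) [𝔮.IsPrime], 𝔮.comap (algebraMap S A) = IsLocalRing.maximalIdeal S →
      ringKrullDim (Localization.AtPrime 𝔮) = ringKrullDim S

/-- The prime `𝔮 = 𝔫 ∩ A` lies over `𝔪_S`. -/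
theorem comap_eq_maximalIdeal (S R A : Type) [CommRing S] [IsLocalRing S]
    [CommRing R] [IsLocalRing R] [Algebra S R] [CommRing A] [Algebra S A]
    (hloc : IsLocalHom (algebraMap S R))
    (𝔫 : Ideal (TensorProduct S A R)) [𝔫.IsPrime]
    (h𝔫 : (IsLocalRing.maximalIdeal R).map
          (Algebra.TensorProduct.includeRight : R →ₐ[S] TensorProduct S A R) ≤ 𝔫) :
    (𝔫.comap (Algebra.TensorProduct.includeLeftRingHom : A →+* TensorProduct S A R)).comap
        (algebraMap S A) = IsLocalRing.maximalIdeal S := by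
  haveI := hloc
  apply le_antisymm
  · apply IsLocalRing.le_maximalIdeal
    intro htop
    apply (inferInstance : 𝔫.IsPrime).ne_top
    rw [Ideal.eq_top_iff_one] at htop ⊢
    have h1 : (1 : TensorProduct S A R) = (1 : A) ⊗ₜ[S] (1 : R) := rfl
    rw [h1]
    simpa [Ideal.mem_comap] using htop
  · intro s hs
    have hsR : algebraMap S R s ∈ IsLocalRing.maximalIdeal R := by
      simpa [IsLocalRing.mem_maximalIdeal, mem_nonunits_iff] using
        (map_mem_nonunits_iff (algebraMap S R) s).mpr
          (by simpa [IsLocalRing.mem_maximalIdeal, mem_nonunits_iff] using hs)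
    have h1 : (Algebra.TensorProduct.includeRight : R →ₐ[S] TensorProduct S A R)
        (algebraMap S R s) ∈ 𝔫 := h𝔫 (Ideal.mem_map_of_mem _ hsR)
    have h2 : (Algebra.TensorProduct.includeRight : R →ₐ[S] TensorProduct S A R)
        (algebraMap S R s) =
        (Algebra.TensorProduct.includeLeftRingHom : A →+* TensorProduct S A R)
          (algebraMap S A s) := by
      simp [Algebra.TensorProduct.includeLeftRingHom, Algebra.TensorProduct.includeRight_apply,
        Algebra.algebraMap_eq_smul_one]
    rw [Ideal.mem_comap, Ideal.mem_comap, ← h2]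
    exact h1

section FibreProof

open TensorProduct Algebra.TensorProduct

variable {S R A : Type} [CommRing S] [IsLocalRing S] [CommRing R] [IsLocalRing R] [Algebra S R]
  [CommRing A] [Algebra S A]

/-- `𝔪_S` maps into `𝔫`. -/
theorem algebraMap_mem_of_mem_maximalIdeal (hloc : IsLocalHom (algebraMap S R))
    (𝔫 : Ideal (A ⊗[S] R))
    (h𝔫 : (IsLocalRing.maximalIdeal R).map
          (Algebra.TensorProduct.includeRight : R →ₐ[S] A ⊗[S] R) ≤ 𝔫)
    (s : S) (hs : s ∈ IsLocalRing.maximalIdeal S) :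
    algebraMap S (A ⊗[S] R) s ∈ 𝔫 := by
  haveI := hloc
  have hsR : algebraMap S R s ∈ IsLocalRing.maximalIdeal R := by
    simpa [IsLocalRing.mem_maximalIdeal, mem_nonunits_iff] using
      (map_mem_nonunits_iff (algebraMap S R) s).mpr
        (by simpa [IsLocalRing.mem_maximalIdeal, mem_nonunits_iff] using hs)
  have : algebraMap S (A ⊗[S] R) s =
      (Algebra.TensorProduct.includeRight : R →ₐ[S] A ⊗[S] R) (algebraMap S R s) :=
    ((Algebra.TensorProduct.includeRight : R →ₐ[S] A ⊗[S] R).commutes s).symm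
  rw [this]
  exact h𝔫 (Ideal.mem_map_of_mem _ hsR)

/-- MAIN ELEMENTWISE LEMMA: for `a ∈ 𝔮 := 𝔫 ∩ A` there is `s ∉ 𝔮` with `s * a ∈ 𝔪_S A`. -/
theorem exists_mul_mem_of_fieldFibre (hloc : IsLocalHom (algebraMap S R))
    (𝔫 : Ideal (A ⊗[S] R)) [𝔫.IsPrime]
    (h𝔫 : (IsLocalRing.maximalIdeal R).map
          (Algebra.TensorProduct.includeRight : R →ₐ[S] A ⊗[S] R) ≤ 𝔫)
    (hfib : ∀ b ∈ 𝔫, ∃ u ∉ 𝔫, u * b ∈ (IsLocalRing.maximalIdeal R).map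
          (Algebra.TensorProduct.includeRight : R →ₐ[S] A ⊗[S] R))
    (a : A) (ha : a ∈ 𝔫.comap (Algebra.TensorProduct.includeLeftRingHom : A →+* A ⊗[S] R)) :
    ∃ s ∉ 𝔫.comap (Algebra.TensorProduct.includeLeftRingHom : A →+* A ⊗[S] R),
      s * a ∈ (IsLocalRing.maximalIdeal S).map (algebraMap S A) := by
  classical
  haveI := hloc
  by_contra hcon
  push Not at hcon
  obtain ⟨u, hu𝔫, hu⟩ := hfib (a ⊗ₜ[S] (1 : R)) (by simpa [Ideal.mem_comap] using ha)
  haveI hIne : Nontrivial (A ⊗[S] R ⧸ 𝔫) :=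
    Ideal.Quotient.nontrivial_iff.mpr (Ideal.IsPrime.ne_top inferInstance)
  letI algkF : Algebra (IsLocalRing.ResidueField S)
      (A ⧸ (IsLocalRing.maximalIdeal S).map (algebraMap S A)) :=
    inferInstanceAs (Algebra (S ⧸ IsLocalRing.maximalIdeal S)
      (A ⧸ (IsLocalRing.maximalIdeal S).map (algebraMap S A)))
  haveI towkF : IsScalarTower S (IsLocalRing.ResidueField S)
      (A ⧸ (IsLocalRing.maximalIdeal S).map (algebraMap S A)) :=
    inferInstanceAs (IsScalarTower S (S ⧸ IsLocalRing.maximalIdeal S)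
      (A ⧸ (IsLocalRing.maximalIdeal S).map (algebraMap S A)))
  have hS0 : ∀ s ∈ IsLocalRing.maximalIdeal S, (algebraMap S (A ⊗[S] R ⧸ 𝔫)) s = 0 := by
    intro s hs
    rw [IsScalarTower.algebraMap_apply S (A ⊗[S] R) (A ⊗[S] R ⧸ 𝔫), Ideal.Quotient.algebraMap_eq,
      Ideal.Quotient.eq_zero_iff_mem]
    exact algebraMap_mem_of_mem_maximalIdeal hloc 𝔫 h𝔫 s hs
  let κ : IsLocalRing.ResidueField S →+* (A ⊗[S] R ⧸ 𝔫) :=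
    Ideal.Quotient.lift (IsLocalRing.maximalIdeal S) (algebraMap S (A ⊗[S] R ⧸ 𝔫)) hS0
  letI algkD : Algebra (IsLocalRing.ResidueField S) (A ⊗[S] R ⧸ 𝔫) := κ.toAlgebra
  have hκ : ∀ s : S, algebraMap (IsLocalRing.ResidueField S) (A ⊗[S] R ⧸ 𝔫)
      (IsLocalRing.residue S s) = Ideal.Quotient.mk 𝔫 (algebraMap S (A ⊗[S] R) s) := fun s => rfl
  let f : A →ₐ[S] (IsLocalRing.ResidueField R ⊗[IsLocalRing.ResidueField S]
      (A ⧸ (IsLocalRing.maximalIdeal S).map (algebraMap S A))) :=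
    { toRingHom := (Algebra.TensorProduct.includeRight :
          (A ⧸ (IsLocalRing.maximalIdeal S).map (algebraMap S A)) →ₐ[IsLocalRing.ResidueField S]
          (IsLocalRing.ResidueField R ⊗[IsLocalRing.ResidueField S]
            (A ⧸ (IsLocalRing.maximalIdeal S).map (algebraMap S A)))).toRingHom.comp
        (Ideal.Quotient.mk ((IsLocalRing.maximalIdeal S).map (algebraMap S A)))
      commutes' := fun s => by
        show (1 : IsLocalRing.ResidueField R) ⊗ₜ[IsLocalRing.ResidueField S]
            (Ideal.Quotient.mk ((IsLocalRing.maximalIdeal S).map (algebraMap S A))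
              (algebraMap S A s)) =
          algebraMap S (IsLocalRing.ResidueField R ⊗[IsLocalRing.ResidueField S]
            (A ⧸ (IsLocalRing.maximalIdeal S).map (algebraMap S A))) s
        rw [Algebra.TensorProduct.algebraMap_apply]
        have e1 : Ideal.Quotient.mk ((IsLocalRing.maximalIdeal S).map (algebraMap S A))
            (algebraMap S A s) =
            (algebraMap S (IsLocalRing.ResidueField S) s) •
              (1 : A ⧸ (IsLocalRing.maximalIdeal S).map (algebraMap S A)) := by
          rw [← Algebra.algebraMap_eq_smul_one, ← IsScalarTower.algebraMap_apply,
            Ideal.Quotient.mk_algebraMap]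
        have e2 : algebraMap S (IsLocalRing.ResidueField R) s =
            (algebraMap S (IsLocalRing.ResidueField S) s) • (1 : IsLocalRing.ResidueField R) := by
          rw [← Algebra.algebraMap_eq_smul_one, ← IsScalarTower.algebraMap_apply]
        rw [e1, e2, TensorProduct.tmul_smul, TensorProduct.smul_tmul'] }
  let g : R →ₐ[S] (IsLocalRing.ResidueField R ⊗[IsLocalRing.ResidueField S]
      (A ⧸ (IsLocalRing.maximalIdeal S).map (algebraMap S A))) :=
    (Algebra.TensorProduct.includeLeft :
        IsLocalRing.ResidueField R →ₐ[S] (IsLocalRing.ResidueField R ⊗[IsLocalRing.ResidueField S]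
          (A ⧸ (IsLocalRing.maximalIdeal S).map (algebraMap S A)))).comp
      (IsScalarTower.toAlgHom S R (IsLocalRing.ResidueField R))
  let φ := Algebra.TensorProduct.lift f g (fun x y => Commute.all _ _)
  have hφ : ∀ (x : A) (r : R), φ (x ⊗ₜ[S] r) =
      (IsLocalRing.residue R r) ⊗ₜ[IsLocalRing.ResidueField S]
        (Ideal.Quotient.mk ((IsLocalRing.maximalIdeal S).map (algebraMap S A)) x) := by
    intro x r
    simp only [φ, Algebra.TensorProduct.lift_tmul]
    show ((1 : IsLocalRing.ResidueField R) ⊗ₜ[IsLocalRing.ResidueField S]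
        (Ideal.Quotient.mk ((IsLocalRing.maximalIdeal S).map (algebraMap S A)) x)) *
        ((IsLocalRing.residue R r) ⊗ₜ[IsLocalRing.ResidueField S] 1) = _
    rw [Algebra.TensorProduct.tmul_mul_tmul, one_mul, mul_one]
  have hJ : (IsLocalRing.maximalIdeal R).map
      (Algebra.TensorProduct.includeRight : R →ₐ[S] A ⊗[S] R) ≤ RingHom.ker φ.toRingHom := by
    rw [Ideal.map_le_iff_le_comap]
    intro m hm
    rw [Ideal.mem_comap, RingHom.mem_ker, AlgHom.toRingHom_eq_coe, RingHom.coe_coe,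
      Algebra.TensorProduct.includeRight_apply, hφ, map_one,
      (IsLocalRing.residue_eq_zero_iff m).mpr hm, TensorProduct.zero_tmul]
  have hφu : φ u * ((1 : IsLocalRing.ResidueField R) ⊗ₜ[IsLocalRing.ResidueField S]
      (Ideal.Quotient.mk ((IsLocalRing.maximalIdeal S).map (algebraMap S A)) a)) = 0 := by
    have := hJ hu
    rw [RingHom.mem_ker, AlgHom.toRingHom_eq_coe, RingHom.coe_coe, map_mul, hφ, map_one] at this
    exact this
  let μ : (A ⧸ (IsLocalRing.maximalIdeal S).map (algebraMap S A)) →ₗ[IsLocalRing.ResidueField S]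
      (A ⧸ (IsLocalRing.maximalIdeal S).map (algebraMap S A)) :=
    LinearMap.mulRight (IsLocalRing.ResidueField S)
      (Ideal.Quotient.mk ((IsLocalRing.maximalIdeal S).map (algebraMap S A)) a)
  have hex : Function.Exact (LinearMap.ker μ).subtype μ := LinearMap.exact_subtype_ker_map μ
  have hexL := Module.Flat.lTensor_exact (IsLocalRing.ResidueField R) hex
  have hμL : ∀ z : IsLocalRing.ResidueField R ⊗[IsLocalRing.ResidueField S]
      (A ⧸ (IsLocalRing.maximalIdeal S).map (algebraMap S A)),
      (μ.lTensor (IsLocalRing.ResidueField R)) z =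
        z * ((1 : IsLocalRing.ResidueField R) ⊗ₜ[IsLocalRing.ResidueField S]
          (Ideal.Quotient.mk ((IsLocalRing.maximalIdeal S).map (algebraMap S A)) a)) := by
    intro z
    induction z using TensorProduct.induction_on with
    | zero => simp
    | tmul l x =>
        rw [LinearMap.lTensor_tmul, Algebra.TensorProduct.tmul_mul_tmul, mul_one]
        rfl
    | add z₁ z₂ h₁ h₂ => rw [map_add, h₁, h₂, add_mul]
  have hrange : φ u ∈ Set.range ((LinearMap.ker μ).subtype.lTensor (IsLocalRing.ResidueField R)) := by
    rw [← hexL (φ u), hμL]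
    exact hφu
  obtain ⟨w, hw⟩ := hrange
  have hR0 : ∀ r ∈ IsLocalRing.maximalIdeal R,
      ((Ideal.Quotient.mk 𝔫).comp
        (Algebra.TensorProduct.includeRight : R →ₐ[S] A ⊗[S] R).toRingHom) r = 0 := by
    intro r hr
    rw [RingHom.comp_apply, Ideal.Quotient.eq_zero_iff_mem]
    exact h𝔫 (Ideal.mem_map_of_mem _ hr)
  let ψL : IsLocalRing.ResidueField R →ₐ[IsLocalRing.ResidueField S] (A ⊗[S] R ⧸ 𝔫) :=
    { toRingHom := Ideal.Quotient.lift (IsLocalRing.maximalIdeal R)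
          ((Ideal.Quotient.mk 𝔫).comp
            (Algebra.TensorProduct.includeRight : R →ₐ[S] A ⊗[S] R).toRingHom) hR0
      commutes' := fun c => by
        obtain ⟨s, rfl⟩ := IsLocalRing.residue_surjective c
        rw [hκ s, IsLocalRing.ResidueField.algebraMap_residue]
        show Ideal.Quotient.mk 𝔫 ((Algebra.TensorProduct.includeRight : R →ₐ[S] A ⊗[S] R)
          (algebraMap S R s)) = _
        rw [AlgHom.commutes] }
  have hle𝔮 : (IsLocalRing.maximalIdeal S).map (algebraMap S A) ≤
      𝔫.comap (Algebra.TensorProduct.includeLeftRingHom : A →+* A ⊗[S] R) := by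
    rw [Ideal.map_le_iff_le_comap]
    intro s hs
    rw [Ideal.mem_comap, Ideal.mem_comap]
    have : (Algebra.TensorProduct.includeLeftRingHom : A →+* A ⊗[S] R) (algebraMap S A s) =
        algebraMap S (A ⊗[S] R) s := by
      rw [Algebra.TensorProduct.includeLeftRingHom_apply, Algebra.TensorProduct.algebraMap_apply]
    rw [this]
    exact algebraMap_mem_of_mem_maximalIdeal hloc 𝔫 h𝔫 s hs
  have hA0 : ∀ x ∈ (IsLocalRing.maximalIdeal S).map (algebraMap S A),
      ((Ideal.Quotient.mk 𝔫).comp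
        (Algebra.TensorProduct.includeLeftRingHom : A →+* A ⊗[S] R)) x = 0 := by
    intro x hx
    rw [RingHom.comp_apply, Ideal.Quotient.eq_zero_iff_mem]
    exact hle𝔮 hx
  let ψF : (A ⧸ (IsLocalRing.maximalIdeal S).map (algebraMap S A)) →ₐ[IsLocalRing.ResidueField S]
      (A ⊗[S] R ⧸ 𝔫) :=
    { toRingHom := Ideal.Quotient.lift ((IsLocalRing.maximalIdeal S).map (algebraMap S A))
          ((Ideal.Quotient.mk 𝔫).comp
            (Algebra.TensorProduct.includeLeftRingHom : A →+* A ⊗[S] R)) hA0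
      commutes' := fun c => by
        obtain ⟨s, rfl⟩ := IsLocalRing.residue_surjective c
        rw [hκ s]
        have : algebraMap (IsLocalRing.ResidueField S)
            (A ⧸ (IsLocalRing.maximalIdeal S).map (algebraMap S A)) (IsLocalRing.residue S s) =
            Ideal.Quotient.mk _ (algebraMap S A s) := rfl
        rw [this]
        rfl }
  let ψ := Algebra.TensorProduct.lift ψL ψF (fun x y => Commute.all _ _)
  have hψ : ∀ (r : R) (x : A), ψ ((IsLocalRing.residue R r) ⊗ₜ[IsLocalRing.ResidueField S]
      (Ideal.Quotient.mk ((IsLocalRing.maximalIdeal S).map (algebraMap S A)) x)) =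
      Ideal.Quotient.mk 𝔫 (x ⊗ₜ[S] r) := by
    intro r x
    simp only [ψ, Algebra.TensorProduct.lift_tmul]
    show Ideal.Quotient.mk 𝔫 ((1 : A) ⊗ₜ[S] r) * Ideal.Quotient.mk 𝔫 (x ⊗ₜ[S] (1 : R)) = _
    rw [← map_mul, Algebra.TensorProduct.tmul_mul_tmul, one_mul, mul_one]
  have hψφ : ∀ t : A ⊗[S] R, ψ (φ t) = Ideal.Quotient.mk 𝔫 t := by
    intro t
    induction t using TensorProduct.induction_on with
    | zero => simp
    | tmul x r => rw [hφ, hψ]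
    | add t₁ t₂ h₁ h₂ => rw [map_add, map_add, h₁, h₂, map_add]
  have hψN : ∀ w' : IsLocalRing.ResidueField R ⊗[IsLocalRing.ResidueField S] (LinearMap.ker μ),
      ψ (((LinearMap.ker μ).subtype.lTensor (IsLocalRing.ResidueField R)) w') = 0 := by
    intro w'
    induction w' using TensorProduct.induction_on with
    | zero => simp
    | tmul l n =>
        rw [LinearMap.lTensor_tmul]
        obtain ⟨r, rfl⟩ := IsLocalRing.residue_surjective l
        obtain ⟨x, hx⟩ := Ideal.Quotient.mk_surjective (n : A ⧸ (IsLocalRing.maximalIdeal S).map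
          (algebraMap S A))
        have hn : (LinearMap.ker μ).subtype n = Ideal.Quotient.mk _ x := by simp [hx]
        rw [hn, hψ, Ideal.Quotient.eq_zero_iff_mem]
        have hxa : x * a ∈ (IsLocalRing.maximalIdeal S).map (algebraMap S A) := by
          have h0 := LinearMap.mem_ker.mp n.2
          simp only [μ, LinearMap.mulRight_apply] at h0
          rw [← Ideal.Quotient.eq_zero_iff_mem, map_mul, hx]
          exact h0
        have hx𝔮 : x ∈ 𝔫.comap (Algebra.TensorProduct.includeLeftRingHom : A →+* A ⊗[S] R) := by
          by_contra hx'
          exact hcon x hx' hxa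
        have : x ⊗ₜ[S] r = (Algebra.TensorProduct.includeLeftRingHom x) * ((1 : A) ⊗ₜ[S] r) := by
          rw [Algebra.TensorProduct.includeLeftRingHom_apply, Algebra.TensorProduct.tmul_mul_tmul,
            mul_one, one_mul]
        rw [this]
        exact 𝔫.mul_mem_right _ (Ideal.mem_comap.mp hx𝔮)
    | add w₁ w₂ h₁ h₂ => rw [map_add, map_add, h₁, h₂, add_zero]
  apply hu𝔫
  rw [← Ideal.Quotient.eq_zero_iff_mem, ← hψφ u, ← hw]
  exact hψN w

end FibreProof

end Summit.ResolutionOfSingularities.ResolutionOfSingularities.Theorems.Descent.FieldFibre
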